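import Literature.AnabelianGeometry.SemiGraphs.TemperedSpecialFibreTower
import HarnessLib

/-!
# Special-fibre towers: the levels can be taken strictly decreasing, and then the level determines
# the admissible kernel ([SemiAnbd] Ex. 3.10 p. 44)

Mochizuki, *Semi-graphs of anabelioids*, Publ. RIMS **42** (2006) [SemiAnbd], Example 3.10 p. 44:
"an exhaustive sequence of open characteristic [hence normal] subgroups of finite index
`… ⊆ N_i ⊆ … ⊆ Δ`" and p. 45 ll. 1–3 "`Δ ↠ … ↠ Δ[i] ↠ … ↠ Δ[j] ↠ …`", typed by abc-iut-L3 as the structure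
`SpecialFibreTower` (`TemperedSpecialFibreTower.lean`: `N` antitone in `i : ℕ`, `N_finiteIndex`,
`N_exhaustive : ⋂ N_i = 1`, `admKer_antitone`). [cite: MochizukiSemiAnbd2006, Ex 3.10 p.44]

PROOF-ONLY file (abc-iut cell, seat abc-iut-L5-d3 gen 7; no definition, no named fact; Mathlib + one
tree file).  Context: GAP-LEDGER G-L5t11g6-2 asked for the reading `admKer_of_N_le : N j ≤ N i →
admKer j ≤ admKer i` ("the admissible kernel is determined by the level"; in print the levels are indexed
by the subgroups themselves), whose consumer-side binder `hNinj` lives in abc-iut-L5-t11's tower files;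
disposition D-G-L5t11g6-2-2 (abc-iut-L5-lead, 08:30Z) keeps it as a consumer binder.  Kernel facts recorded
here, over the UNCHANGED interface:

* `SpecialFibreTower.admKer_le_of_N_le_of_strictAnti` / `admKer_of_N_le_of_strictAnti` — if the levels are
  STRICTLY decreasing, the wanted reading holds (`N j ≤ N i` forces `i ≤ j`, then `admKer_antitone`; the second
  form is the consumer binder `hNinj` verbatim);
* `exists_strictMono_strictAnti_comp` — pure order theory: a sequence that drops strictly beyond every
  index has a strictly decreasing subsequence along a strictly increasing reindexing;
* `SpecialFibreTower.exists_N_lt` — for INFINITE `Δ` the levels never stabilise (a stabilised level would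
  equal `⋂ N_i = 1`, a finite-index trivial subgroup, forcing `Δ` finite);
* `SpecialFibreTower.exists_strictMono_strictAnti_N` — hence a strictly increasing `φ : ℕ → ℕ` with
  `N ∘ φ` strictly decreasing exists, along which the first lemma applies.

Nothing here takes a side on [IUTchIII] Cor. 3.12; no statement of [SemiAnbd] is strengthened.
-/

namespace Literature.AnabelianGeometry.SemiGraphs

universe u

/-- Pure order theory: if a sequence `N : ℕ → α` drops strictly beyond every index
(`∀ i, ∃ j > i, N j < N i`), then along some strictly increasing `φ : ℕ → ℕ` the subsequence `N ∘ φ` is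
strictly decreasing (iterate a choice of such a `j`). [cite: MochizukiSemiAnbd2006, Ex 3.10 p.44] -/
theorem exists_strictMono_strictAnti_comp {α : Type*} [Preorder α] (N : ℕ → α)
    (h : ∀ i, ∃ j, i < j ∧ N j < N i) :
    ∃ φ : ℕ → ℕ, StrictMono φ ∧ StrictAnti (N ∘ φ) := by
  choose g hg using h
  refine ⟨fun k => g^[k] 0, strictMono_nat_of_lt_succ fun k => ?_,
    strictAnti_nat_of_succ_lt fun k => ?_⟩
  · rw [Function.iterate_succ_apply']
    exact (hg _).1
  · simp only [Function.comp_apply, Function.iterate_succ_apply']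
    exact (hg _).2

namespace SpecialFibreTower

variable {Δ : Type u} [Group Δ] [TopologicalSpace Δ] (T : SpecialFibreTower Δ)

/-- If the levels `N_i` of a special-fibre tower are STRICTLY decreasing, then the admissible kernel is
determined by the level: `N j ≤ N i → admKer j ≤ admKer i` (the reading of "`Δ[i] ↠ Δ[j]`", p. 45
ll. 1–3, keyed on the level subgroups rather than on the index; `N j ≤ N i` forces `i ≤ j`, and
`admKer` is antitone). [cite: MochizukiSemiAnbd2006, Ex 3.10 p.45] -/
theorem admKer_le_of_N_le_of_strictAnti (hN : StrictAnti T.N) {i j : ℕ} (h : T.N j ≤ T.N i) :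
    T.admKer j ≤ T.admKer i := by
  rcases le_or_gt i j with hij | hji
  · exact T.admKer_antitone hij
  · exact absurd (lt_of_lt_of_le (hN hji) h) (lt_irrefl _)

/-- The same in the exact shape of the consumer binder `hNinj` of abc-iut-L5-t11's tower files
(`∀ i j, N j ≤ N i → admKer j ≤ admKer i`, GAP-LEDGER G-L5t11g6-2): discharged whenever the levels are
strictly decreasing. [cite: MochizukiSemiAnbd2006, Ex 3.10 p.45] -/
theorem admKer_of_N_le_of_strictAnti (hN : StrictAnti T.N) :
    ∀ i j, T.N j ≤ T.N i → T.admKer j ≤ T.admKer i :=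
  fun _ _ h => T.admKer_le_of_N_le_of_strictAnti hN h

/-- In an INFINITE `Δ` the levels of a special-fibre tower never stabilise: beyond every index there is a
strictly smaller level.  (If `N_j = N_i` for all `j > i`, then `N_i = ⋂_j N_j = 1` by antitonicity and
exhaustiveness, a trivial subgroup of finite index, so `Δ` would be finite.)
[cite: MochizukiSemiAnbd2006, Ex 3.10 p.44] -/
theorem exists_N_lt [Infinite Δ] (i : ℕ) : ∃ j, i < j ∧ T.N j < T.N i := by
  by_contra h
  push Not at h
  have hconst : ∀ j, i < j → T.N j = T.N i := fun j hj =>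
    (eq_of_le_of_not_lt (T.N_antitone hj.le) (h j hj))
  have hbot : T.N i = ⊥ := by
    rw [eq_bot_iff]
    intro g hg
    have : g = 1 := T.N_exhaustive g fun j => by
      rcases le_or_gt j i with hji | hij
      · exact T.N_antitone hji hg
      · rw [hconst j hij]; exact hg
    rw [this]; exact (⊥ : Subgroup Δ).one_mem
  have hfi := T.N_finiteIndex i
  rw [hbot] at hfi
  have : Finite Δ := Nat.finite_of_card_ne_zero (by rw [← Subgroup.index_bot]; exact hfi.index_ne_zero)
  exact not_finite Δ

/-- For INFINITE `Δ`, some strictly increasing reindexing `φ : ℕ → ℕ` makes the levels `N (φ k)` strictly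
decreasing ("`… ⊆ N_i ⊆ …`" may be taken strictly decreasing without loss), so that
`admKer_le_of_N_le_of_strictAnti` applies along `φ`. [cite: MochizukiSemiAnbd2006, Ex 3.10 p.44] -/
theorem exists_strictMono_strictAnti_N [Infinite Δ] :
    ∃ φ : ℕ → ℕ, StrictMono φ ∧ StrictAnti (T.N ∘ φ) :=
  exists_strictMono_strictAnti_comp T.N T.exists_N_lt

/-- Along such a reindexing the wanted reading holds: for a strictly increasing `φ` with `N ∘ φ` strictly
decreasing, `N (φ b) ≤ N (φ a) → admKer (φ b) ≤ admKer (φ a)`.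
[cite: MochizukiSemiAnbd2006, Ex 3.10 p.45] -/
theorem admKer_comp_le_of_N_comp_le {φ : ℕ → ℕ} (hφ : StrictMono φ) (hN : StrictAnti (T.N ∘ φ))
    {a b : ℕ} (h : T.N (φ b) ≤ T.N (φ a)) : T.admKer (φ b) ≤ T.admKer (φ a) := by
  rcases le_or_gt a b with hab | hba
  · exact T.admKer_antitone (hφ.monotone hab)
  · exact absurd (lt_of_lt_of_le (hN hba) h) (lt_irrefl _)

end SpecialFibreTower

end Literature.AnabelianGeometry.SemiGraphs
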